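import Mathlib
import Summits.ResolutionOfSingularities.ResolutionOfSingularities.Theorems.WildQuotientsWildQuotientResolutionPthConeFanExponents
import Summits.ResolutionOfSingularities.ResolutionOfSingularities.Theorems.WildQuotientsWildQuotientResolutionPthConeIrrelevant
import Summits.ResolutionOfSingularities.ResolutionOfSingularities.Theorems.WildQuotientsWildQuotientResolutionPthConeVeronese

/-!
# The toric fan blow-up: every generator chart lies in a vertex chart (Rees relations)
(crux stmt-ResolutionOfSingularities-15640 `WildQuotients.WildQuotientResolution`, line `Sketch`;
chain w45c POST-V5 S2 brick F6 `…ConductorOneToricFan` = toric brick `T(a,b)` of res-L1-w45c-lead-1's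
`S2-DESIGN.md` §3 («the vertex charts cover affineBlowup 𝔞 (edge generators' charts lie in the two
adjacent vertex charts)») / §7 (7.6). [OURS · L1 W4.5c] — NOT a statement of any manuscript; replaces the
role of no printed item. Owner res-L1-w45c-stub-4 (gen 5).)

For the fan family `c = PthCone.fanFamily n p A k` every generator chart `D₊(c_κ t)` is contained in a
VERTEX chart, by a monomial relation `c_κ^q = c_{κ₀} · u`, `u ∈ 𝔞^{q−1}`, in the Rees algebra
(`PthCone.basicOpen_le_of_pow_eq_mul`, …PthConeVeronese):
`x^{p²} = x^{p(p−1)}·x^p`; `(x_ρ^{R−1}x_l)^R = (x_ρ^R)^{R−1} x_l^R` (`R = p(p−1)` or `(p−j)(p−j−1)`); the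
mid-points are mid-points: `(x^{Q_i})² = x^{m_{i−1}} x^{m_i}`; `(x_ρ^{(p−1)²}x_{l'})² = x_ρ^{p(p−1)} · x^{m_1(ρ,l')}`.
* `PthCone.basicOpen_le_of_coneRel` — generic: `c_i^q = c_j u`, `u ∈ 𝔞^{q−1}` ⇒ `D₊(c_i t) ≤ D₊(c_j t)`;
* `PthCone.exists_fanExp_eq_vtxExp / _qExp` — every vertex `m_j` (`0 ≤ j ≤ p−1`) / mid-point is a generator;
* `PthCone.basicOpen_*_le` — the relations for the kinds `q0 e0 x0 qp ep xp qm ea eb`.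
No notation.
-/

set_option linter.dupNamespace false

noncomputable section

open MvPolynomial AlgebraicGeometry
open Literature.AlgebraicGeometry.Resolution

namespace Summit.ResolutionOfSingularities.ResolutionOfSingularities.Theorems.WildQuotientResolution.PthCone

open ConductorOne

universe u

/-- **Rees relation ⇒ chart inclusion** (generic): if `c_i ^ q = c_j · u` with `u ∈ 𝔞^{q−1}`, `q ≥ 1`,
`𝔞 = (c_0,…,c_{m−1})`, then `D₊(c_i t) ≤ D₊(c_j t)` in `Proj R[𝔞t]`. [folklore] -/
theorem basicOpen_le_of_coneRel {R : Type u} [CommRing R] {m : ℕ} (c : Fin m → R) (i j : Fin m)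
    {q : ℕ} (hq : 1 ≤ q) {u : R} (hu : u ∈ Ideal.span (Set.range c) ^ (q - 1)) (h : c i ^ q = c j * u) :
    Proj.basicOpen (reesGrading (Ideal.span (Set.range c)))
        (reesT (c i) (Ideal.mem_span_range_self (f := c) (x := i))) ≤
      Proj.basicOpen (reesGrading (Ideal.span (Set.range c)))
        (reesT (c j) (Ideal.mem_span_range_self (f := c) (x := j))) := by
  refine basicOpen_le_of_pow_eq_mul _ _ _
    (⟨Polynomial.monomial (q - 1) u, reesAlgebra.monomial_mem.mpr hu⟩ :
      reesAlgebra (Ideal.span (Set.range c))) hq (Subtype.ext ?_)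
  rw [Subalgebra.coe_pow, Subalgebra.coe_mul, coe_reesT, coe_reesT, Polynomial.monomial_pow,
    Polynomial.monomial_mul_monomial, show 1 * q = 1 + (q - 1) by omega, h]

variable (k : Type) [Field k] (n p : ℕ) (A : Finset (Fin n))

/-! ## Every vertex and every edge mid-point is a generator -/

/-- The vertex exponent `m_j = (p−j)(p−j−1)𝐞_ρ + j(j+1)𝐞_{ρ'}` (`0 ≤ j ≤ p−1`) is the exponent of a
fan generator (`v0`, `vm` or `vp`). [OURS · L1 W4.5c] -/
theorem exists_fanExp_eq_vtxExp (j : ℕ) (hj : j + 1 ≤ p) (ρ : A) (ρ' : (Aᶜ : Finset (Fin n))) :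
    ∃ κ : FIdx n p A, fanExp n p A κ = vtxExp n p j ρ ρ' := by
  by_cases h0 : j = 0
  · refine ⟨FIdx.v0 ρ, ?_⟩
    rw [fanExp_v0, vtxExp, h0, Nat.sub_zero, zero_mul, Finsupp.single_zero, add_zero]
  · by_cases h1 : j = p - 1
    · refine ⟨FIdx.vp ρ', ?_⟩
      rw [fanExp_vp, vtxExp, h1, show p - (p - 1) = 1 by omega, show 1 - 1 = 0 from rfl, mul_zero,
        Finsupp.single_zero, zero_add, show p - 1 + 1 = p by omega, mul_comm]
    · refine ⟨FIdx.vm ⟨j - 1, by omega⟩ ρ ρ', ?_⟩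
      rw [fanExp_vm, show ((⟨j - 1, _⟩ : Fin (p - 2)) : ℕ) + 1 = j from by simp; omega]

/-- The mid-point exponent `Q_i = (p−i)²𝐞_ρ + i²𝐞_{ρ'}` (`0 ≤ i ≤ p`) is the exponent of a fan generator
(`q0`, `qm` or `qp`). [OURS · L1 W4.5c] -/
theorem exists_fanExp_eq_qExp (i : ℕ) (hi : i ≤ p) (ρ : A) (ρ' : (Aᶜ : Finset (Fin n))) :
    ∃ κ : FIdx n p A, fanExp n p A κ = qExp n p i ρ ρ' := by
  by_cases h0 : i = 0
  · refine ⟨FIdx.q0 ρ, ?_⟩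
    rw [fanExp_q0, qExp, h0, Nat.sub_zero, show (0 : ℕ) ^ 2 = 0 from rfl, Finsupp.single_zero, add_zero]
  · by_cases h1 : i = p
    · refine ⟨FIdx.qp ρ', ?_⟩
      rw [fanExp_qp, qExp, h1, Nat.sub_self, show (0 : ℕ) ^ 2 = 0 from rfl, Finsupp.single_zero, zero_add]
    · refine ⟨FIdx.qm ⟨i - 1, by omega⟩ ρ ρ', ?_⟩
      rw [fanExp_qm, show ((⟨i - 1, _⟩ : Fin (p - 1)) : ℕ) + 1 = i from by simp; omega]

variable [hp : Fact p.Prime]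

/-- A fan generator as a `monomialElem`. [OURS · L1 W4.5c] -/
theorem fanGen_eq_monomialElem (κ : FIdx n p A) :
    fanGen n p A k κ = monomialElem k n p (chartWeight p n A) (fanExp n p A κ) (weight_fanExp n p A κ) :=
  rfl

/-- Products of monomials of the cone: an exponent identity gives a cone identity. [OURS · L1 W4.5c] -/
theorem monomialElem_pow_eq {w : Fin n → ZMod p} (d d₁ d₂ : Fin n →₀ ℕ) (hd : Finsupp.weight w d = 0)
    (hd₁ : Finsupp.weight w d₁ = 0) (hd₂ : Finsupp.weight w d₂ = 0) (q r : ℕ)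
    (h : q • d = d₁ + (r • d₁ + d₂)) :
    monomialElem k n p w d hd ^ q =
      monomialElem k n p w d₁ hd₁ * (monomialElem k n p w d₁ hd₁ ^ r * monomialElem k n p w d₂ hd₂) := by
  apply Subtype.ext
  simp only [SubmonoidClass.coe_pow, Subalgebra.coe_mul, coe_monomialElem, monomial_pow, one_pow,
    monomial_mul, one_mul, h]

/-- The fan ideal of the family: `Ideal.span (range fanFamily) = fanIdeal`. [OURS · L1 W4.5c] -/
theorem span_range_fanFamily : Ideal.span (Set.range (fanFamily n p A k)) = fanIdeal n p A k := rfl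

/-- A power of a generator times a generator lies in the right power of the fan ideal. [OURS · L1 W4.5c] -/
theorem pow_mul_mem_pow (κ₁ κ₂ : FIdx n p A) (r : ℕ) :
    fanGen n p A k κ₁ ^ r * fanGen n p A k κ₂ ∈ Ideal.span (Set.range (fanFamily n p A k)) ^ (r + 1) := by
  rw [pow_succ]
  exact Ideal.mul_mem_mul (Ideal.pow_mem_pow (fanGen_mem_fanIdeal n p A k κ₁) r) (fanGen_mem_fanIdeal n p A k κ₂)

/-! ## The relations, kind by kind -/

/-- `D₊(x_ρ^{p²} t) ≤ D₊(x_ρ^{p(p−1)} t)` (`x^{p²} = x^{p(p−1)} · x^p`); stated for any index `κ₀` with the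
vertex exponent `p(p−1)𝐞_σ` and `κ` with exponent `p²𝐞_σ` (covers `q0` and `qp`). [OURS · L1 W4.5c] -/
theorem basicOpen_le_of_pure (κ κ₀ : FIdx n p A) (σ : Fin n) (hκ : fanExp n p A κ = Finsupp.single σ (p ^ 2))
    (hκ₀ : fanExp n p A κ₀ = Finsupp.single σ (p * (p - 1))) :
    Proj.basicOpen (reesGrading (Ideal.span (Set.range (fanFamily n p A k))))
        (reesT (fanFamily n p A k (Fintype.equivFin (FIdx n p A) κ))
          (Ideal.mem_span_range_self (f := fanFamily n p A k) (x := Fintype.equivFin (FIdx n p A) κ))) ≤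
      Proj.basicOpen (reesGrading (Ideal.span (Set.range (fanFamily n p A k))))
        (reesT (fanFamily n p A k (Fintype.equivFin (FIdx n p A) κ₀))
          (Ideal.mem_span_range_self (f := fanFamily n p A k) (x := Fintype.equivFin (FIdx n p A) κ₀))) := by
  have hp1 : 1 ≤ p := hp.out.one_lt.le
  refine basicOpen_le_of_coneRel (fanFamily n p A k) _ _ (q := 1) le_rfl
    (u := ⟨X σ ^ p, X_pow_mem_cone_of_dvd k n p _ σ dvd_rfl⟩) (by rw [Nat.sub_self, pow_zero, Ideal.one_eq_top]; trivial) ?_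
  rw [fanFamily_equivFin, fanFamily_equivFin, pow_one]
  apply Subtype.ext
  simp only [Subalgebra.coe_mul, coe_fanGen, hκ, hκ₀, X_pow_eq_monomial, monomial_mul, one_mul,
    ← Finsupp.single_add]
  congr 2
  obtain ⟨m, rfl⟩ : ∃ m, p = m + 1 := ⟨p - 1, by omega⟩
  rw [Nat.add_sub_cancel]
  ring

/-- `D₊(c_κ t) ≤ D₊(c_{κ₀} t)` from an exponent identity `q·d_κ = d_{κ₀} + (r·d_{κ₀} + d_{κ₂})`, `q = r + 2`
(the «moved vertex» relations `(x_σ^{R−1}x_l ⋯)^R = (x_σ^R ⋯)^{R−1}(x_l^R ⋯)` and the mid-point relations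
with `r = 0`). [OURS · L1 W4.5c] -/
theorem basicOpen_le_of_expRel (κ κ₀ κ₂ : FIdx n p A) (r : ℕ)
    (h : (r + 2) • fanExp n p A κ = fanExp n p A κ₀ + (r • fanExp n p A κ₀ + fanExp n p A κ₂)) :
    Proj.basicOpen (reesGrading (Ideal.span (Set.range (fanFamily n p A k))))
        (reesT (fanFamily n p A k (Fintype.equivFin (FIdx n p A) κ))
          (Ideal.mem_span_range_self (f := fanFamily n p A k) (x := Fintype.equivFin (FIdx n p A) κ))) ≤
      Proj.basicOpen (reesGrading (Ideal.span (Set.range (fanFamily n p A k))))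
        (reesT (fanFamily n p A k (Fintype.equivFin (FIdx n p A) κ₀))
          (Ideal.mem_span_range_self (f := fanFamily n p A k) (x := Fintype.equivFin (FIdx n p A) κ₀))) := by
  refine basicOpen_le_of_coneRel (fanFamily n p A k) _ _ (q := r + 2) (by omega)
    (u := fanGen n p A k κ₀ ^ r * fanGen n p A k κ₂) (by
      rw [show r + 2 - 1 = r + 1 by omega]; exact pow_mul_mem_pow k n p A κ₀ κ₂ r) ?_
  rw [fanFamily_equivFin, fanFamily_equivFin, fanGen_eq_monomialElem, fanGen_eq_monomialElem,
    fanGen_eq_monomialElem]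
  exact monomialElem_pow_eq k n p _ _ _ (weight_fanExp n p A κ) (weight_fanExp n p A κ₀)
    (weight_fanExp n p A κ₂) (r + 2) r h

/-! ## The exponent identities -/

/-- `R·((R−1)𝐞_σ + 𝐞_l + e) = (R𝐞_σ + e) + ((R−2)(R𝐞_σ + e) + (R𝐞_l + e))` for `R ≥ 2` (moved vertices; `e`
is the untouched part of the vertex exponent). [folklore] -/
theorem smul_moved_eq (R : ℕ) (hR : 2 ≤ R) (σ l : Fin n) (e : Fin n →₀ ℕ) :
    ((R - 2) + 2) • (Finsupp.single σ (R - 1) + e + Finsupp.single l 1) =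
      (Finsupp.single σ R + e) + ((R - 2) • (Finsupp.single σ R + e) + (Finsupp.single l R + e)) := by
  classical
  obtain ⟨m, rfl⟩ : ∃ m, R = m + 2 := ⟨R - 2, by omega⟩
  have h1 : m + 2 - 1 = m + 1 := by omega
  have h2 : m + 2 - 2 = m := by omega
  rw [h1, h2]
  ext i
  simp only [Finsupp.smul_apply, Finsupp.add_apply, Finsupp.single_apply, smul_eq_mul]
  split_ifs <;> ring

/-- `2·((p−1)²𝐞_σ + 𝐞_l) = p(p−1)𝐞_σ + ((p−1)(p−1−1)𝐞_σ + 1·(1+1)𝐞_l)` (`x0`/`xp` and the vertex `m_1`),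
written with `r = 0`. [folklore] -/
theorem smul_x_eq (hp2 : 2 ≤ p) (σ l : Fin n) (hσl : σ ≠ l) :
    (0 + 2) • (Finsupp.single σ ((p - 1) ^ 2) + Finsupp.single l 1) =
      Finsupp.single σ (p * (p - 1)) + (0 • Finsupp.single σ (p * (p - 1)) +
        (Finsupp.single σ ((p - 1) * (p - 1 - 1)) + Finsupp.single l (1 * (1 + 1)))) := by
  classical
  obtain ⟨m, rfl⟩ : ∃ m, p = m + 2 := ⟨p - 2, by omega⟩
  have h1 : m + 2 - 1 = m + 1 := by omega
  have h2 : m + 1 - 1 = m := by omega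
  rw [h1, h2]
  ext i
  simp only [Finsupp.smul_apply, Finsupp.add_apply, Finsupp.single_apply, smul_eq_mul]
  by_cases hσ : σ = i
  · have hli : ¬l = i := fun h => hσl (hσ.trans h.symm)
    simp only [if_pos hσ, if_neg hli]; ring
  · simp only [if_neg hσ]; split_ifs <;> ring

/-- `2·Q_{i+1} = m_i + (0·m_i + m_{i+1})` (the mid-point relation), `i + 2 ≤ p`. [folklore] -/
theorem smul_q_eq (i : ℕ) (hi : i + 2 ≤ p) (ρ ρ' : Fin n) (hρρ' : ρ ≠ ρ') :
    (0 + 2) • qExp n p (i + 1) ρ ρ' = vtxExp n p i ρ ρ' + (0 • vtxExp n p i ρ ρ' + vtxExp n p (i + 1) ρ ρ') := by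
  classical
  obtain ⟨m, rfl⟩ : ∃ m, p = m + (i + 2) := ⟨p - (i + 2), by omega⟩
  have h1 : m + (i + 2) - (i + 1) = m + 1 := by omega
  have h2 : m + (i + 2) - i = m + 2 := by omega
  have h3 : m + 2 - 1 = m + 1 := by omega
  have h4 : m + 1 - 1 = m := by omega
  rw [qExp, vtxExp, vtxExp, h1, h2, h3, h4]
  ext x
  simp only [Finsupp.smul_apply, Finsupp.add_apply, Finsupp.single_apply, smul_eq_mul]
  by_cases hρ : ρ = x
  · have hρ'x : ¬ρ' = x := fun h => hρρ' (hρ.trans h.symm)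
    simp only [if_pos hρ, if_neg hρ'x]; ring
  · simp only [if_neg hρ]; split_ifs <;> ring

/-- The variant of `smul_moved_eq` with the untouched part written first:
`S·(e + (S−1)𝐞_σ + 𝐞_l) = (e + S𝐞_σ) + ((S−2)(e + S𝐞_σ) + (e + S𝐞_l))`. [folklore] -/
theorem smul_moved_eq' (S : ℕ) (hS : 2 ≤ S) (σ l : Fin n) (e : Fin n →₀ ℕ) :
    ((S - 2) + 2) • (e + Finsupp.single σ (S - 1) + Finsupp.single l 1) =
      (e + Finsupp.single σ S) + ((S - 2) • (e + Finsupp.single σ S) + (e + Finsupp.single l S)) := by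
  classical
  obtain ⟨m, rfl⟩ : ∃ m, S = m + 2 := ⟨S - 2, by omega⟩
  have h1 : m + 2 - 1 = m + 1 := by omega
  have h2 : m + 2 - 2 = m := by omega
  rw [h1, h2]
  ext i
  simp only [Finsupp.smul_apply, Finsupp.add_apply, Finsupp.single_apply, smul_eq_mul]
  split_ifs <;> ring

end Summit.ResolutionOfSingularities.ResolutionOfSingularities.Theorems.WildQuotientResolution.PthCone

end
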